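import Summits.ValiantsHypothesis.ValiantsHypothesis.Theorems.LacunarySymmetroidMatrixDescartesCensusPivotTwoIslands

/-!
# `MatrixDescartes` census — pivot column, EVERY SIZE `m`: the WALL LEMMA (a PSD point of the pencil separates the
# direction parameters of the negativity windows on its two sides)

HONEST FRAMING.  Object-search cell `pub-symmetroid`, Conjecture-B column in PIVOT currency (`…CensusPivotDefs.lean`, seat conjb-1),
seat `val-sym-mdr-p1` (generation 7).  Helper file landed `--supports` the crux item stmt-ValiantsHypothesis-18050
(`Theses.LacunarySymmetroid.MatrixDescartes`, OPEN, on HOLD) with NO closure claim.  The `m`-general form of `…CensusPivotTwoIslands.wall`: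
for ANY real `m × m` pivot letter `J`, PSD letters `Pₖ`, and `0 < u₁ < u₀ < u₂` with `F(u₀) = u₀^e J + ∑ u₀^{dₖ} Pₖ ⪰ 0` (a WALL), every
direction `x` satisfies `u₁^e (−xᵀJx) ≤ ∑ u₁^{dₖ} xᵀPₖx` or `u₂^e (−xᵀJx) ≤ ∑ u₂^{dₖ} xᵀPₖx` (`wall_of_posSemidef`): the negativity windows
`{u : xᵀF(u)x < 0}` (each an interval in `log u`, by convexity of the posynomial `∑ (xᵀPₖx) u^{dₖ−e}`) of directions seen on the two
sides of a wall are disjoint.  With `…CensusPivotIndexOneRoots.posSemidef_at_posRoot` (index one: every positive root is a wall) this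
is the kernel half of the located picture «the sublevel set in `ℝ × ℍ^{m−1}` has components with pairwise disjoint projections on both
factors» (seat memo ENVELOPE-AND-CORE.md §1/§2).  Nothing here bears on `Theses.LacunarySymmetroid.MatrixDescartes` in its window, on
`KPlusLogSqLaw`, on `DoorA26` / `DoorA34`, on the cell's registers or credences, or on `VP ≠ VNP`.

[folklore] Convexity of exponential sums with non-negative weights (tree `Pivot.TwoIslands.posynomial_div_pow_convexOn`,
`Pivot.Convexity.quadForm_eval_pencil`).  No definitions, no named facts.
-/

-- `Summit.ValiantsHypothesis.ValiantsHypothesis.…` repeats a component by the D-0017 layout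
-- (single-conjunct summit), which the `dupNamespace` linter flags; the name is mandated.
set_option linter.dupNamespace false

namespace Summit.ValiantsHypothesis.ValiantsHypothesis.Theorems.LacunarySymmetroidMatrixDescartes.Pivot.Wall

open Matrix Finset Polynomial
open scoped BigOperators

variable {m K : ℕ}

/-- At a PSD point `u₀` of the pencil, `u₀^e · (−xᵀJx) ≤ ∑ u₀^{dₖ} · xᵀPₖx` for every direction `x`. [folklore] -/
theorem pow_mul_le_quadForm_of_posSemidef (e : ℕ) (d : Fin K → ℕ) (J : Matrix (Fin m) (Fin m) ℝ)
    (P : Fin K → Matrix (Fin m) (Fin m) ℝ) {u : ℝ} (hpsd : (u ^ e • J + ∑ k, u ^ d k • P k).PosSemidef) (x : Fin m → ℝ) :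
    u ^ e * (-(x ⬝ᵥ (J *ᵥ x))) ≤ ∑ k, u ^ d k * (x ⬝ᵥ (P k *ᵥ x)) := by
  have h := hpsd.dotProduct_mulVec_nonneg x
  rw [star_trivial, Convexity.quadForm_eval_pencil] at h
  linarith

/-- **THE WALL LEMMA (every size `m`, any pivot letter).**  Let `Pₖ ⪰ 0`, `0 < u₁ < u₀ < u₂`, and suppose the pencil is PSD at `u₀`:
`u₀^e J + ∑ u₀^{dₖ} Pₖ ⪰ 0`.  Then for every direction `x`,
`u₁^e (−xᵀJx) ≤ ∑ u₁^{dₖ} xᵀPₖx` or `u₂^e (−xᵀJx) ≤ ∑ u₂^{dₖ} xᵀPₖx` — a direction whose quadratic form is negative on both sides of a wall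
does not exist. [folklore] -/
theorem wall_of_posSemidef (e : ℕ) (d : Fin K → ℕ) (J : Matrix (Fin m) (Fin m) ℝ) (P : Fin K → Matrix (Fin m) (Fin m) ℝ)
    (hP : ∀ k, (P k).PosSemidef) {u₁ u₀ u₂ : ℝ} (hu₁ : 0 < u₁) (h₁₀ : u₁ < u₀) (h₀₂ : u₀ < u₂)
    (hwall : (u₀ ^ e • J + ∑ k, u₀ ^ d k • P k).PosSemidef) (x : Fin m → ℝ) :
    u₁ ^ e * (-(x ⬝ᵥ (J *ᵥ x))) ≤ ∑ k, u₁ ^ d k * (x ⬝ᵥ (P k *ᵥ x)) ∨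
    u₂ ^ e * (-(x ⬝ᵥ (J *ᵥ x))) ≤ ∑ k, u₂ ^ d k * (x ⬝ᵥ (P k *ᵥ x)) := by
  have hu₀ : 0 < u₀ := hu₁.trans h₁₀
  have hu₂ : 0 < u₂ := hu₀.trans h₀₂
  have hPx : ∀ k, 0 ≤ x ⬝ᵥ (P k *ᵥ x) := fun k => by
    simpa only [star_trivial] using (hP k).dotProduct_mulVec_nonneg x
  set q := -(x ⬝ᵥ (J *ᵥ x)) with hq
  rcases le_or_gt q 0 with hq0 | hqpos
  · -- a non-negative direction of `J`: both sides trivial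
    left
    exact (mul_nonpos_of_nonneg_of_nonpos (pow_nonneg hu₁.le e) hq0).trans
      (Finset.sum_nonneg fun k _ => mul_nonneg (pow_nonneg hu₁.le _) (hPx k))
  · -- a `J`-negative direction: the posynomial `∑ (xᵀPₖx / q) u^{dₖ}` against the monomial `u^e`
    set c : Fin K → ℝ := fun k => x ⬝ᵥ (P k *ᵥ x) / q with hc
    have hc0 : ∀ k, 0 ≤ c k := fun k => div_nonneg (hPx k) hqpos.le
    have hsum : ∀ u : ℝ, ∑ k, c k * u ^ d k = (∑ k, u ^ d k * (x ⬝ᵥ (P k *ᵥ x))) / q := by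
      intro u
      rw [Finset.sum_div]
      exact Finset.sum_congr rfl fun k _ => by rw [hc]; ring
    -- at the wall: `1 ≤ f(log u₀)`
    set f : ℝ → ℝ := fun s => ∑ k, Real.exp (((d k : ℝ) - e) * s) * c k with hf
    have hval : ∀ {u : ℝ}, 0 < u → f (Real.log u) = (∑ k, u ^ d k * (x ⬝ᵥ (P k *ᵥ x))) / q / u ^ e := by
      intro u hu
      rw [hf]
      simp only []
      rw [← TwoIslands.posynomial_div_pow_eq, Real.exp_log hu, hsum]
    have h₀ := pow_mul_le_quadForm_of_posSemidef e d J P hwall x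
    have hf₀ : 1 ≤ f (Real.log u₀) := by
      rw [hval hu₀, le_div_iff₀ (pow_pos hu₀ e), le_div_iff₀ hqpos, one_mul]
      linarith
    by_contra hboth
    push Not at hboth
    obtain ⟨hlt₁, hlt₂⟩ := hboth
    have hf₁ : f (Real.log u₁) < 1 := by
      rw [hval hu₁, div_lt_one (pow_pos hu₁ e), div_lt_iff₀ hqpos]
      linarith
    have hf₂ : f (Real.log u₂) < 1 := by
      rw [hval hu₂, div_lt_one (pow_pos hu₂ e), div_lt_iff₀ hqpos]
      linarith
    have hlt := TwoIslands.lt_one_between (TwoIslands.posynomial_div_pow_convexOn e d c hc0)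
      (Real.log_le_log hu₁ h₁₀.le) (Real.log_le_log hu₀ h₀₂.le) hf₁ hf₂
    exact absurd hf₀ (not_le.2 hlt)

end Summit.ValiantsHypothesis.ValiantsHypothesis.Theorems.LacunarySymmetroidMatrixDescartes.Pivot.Wall
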